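import Summits.HodgeConjecture.HodgeConjecture.Theses.GaloisSieve

/-!
# Birth skeleton (BC3) of the crux `CosetAlgebraicity` (stmt-HodgeConjecture-14561),
# route `GaloisSieve` — line `birth`: Shioda's `(P)`-trichotomy of the indecomposable
# on-line characters (semi-decomposable | quasi-decomposable | `(P)`-irreducible)

`CosetAlgebraicity` (rank 2): for every `p ≥ 2`, every level `m` and every INDECOMPOSABLE Hodge
character `α` of length `2p+2` lying ON A HODGE LINE, the eigenline `V(α) ⊂ H²ᵖ(X²ᵖₘ(ℂ); ℂ)`
(spelled inline as the simultaneous eigenvectors of the diagonal symmetries `g_a`) consists of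
algebraic classes.

The line cuts the crux along Shioda's arithmetic trichotomy of INDECOMPOSABLE elements of the
semigroup `Mₘ` (Proc. Japan Acad. 55A (1979) §1 Definition (ii)–(iii); da Silva, arXiv:2101.04739,
Def. 2.4 and §3), which the tree has as `FermatCharacter.IsQuasiDecomposable` /
`FermatCharacter.IsSemiDecomposable` (FermatShiodaCondition.lean):

  α indecomposable, on a Hodge line
    = (STUB 1, SEMI-DECOMPOSABLE — known in print, unformalised) `{α} = x' + x''`, two zero-sum
      triples: `p = 2` only, `V(α)` comes from `H¹(X¹ₘ) ⊗ H¹(X¹ₘ)(1)` by the type-II map of the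
      inductive structure and is algebraic by Lefschetz `(1,1)` on `X¹ₘ × X¹ₘ` (Shioda 1979 §4,
      the input `IsShiodaClosed.semi` of the tree's spine) — NO line hypothesis needed;
    ⊔ (STUB 2, QUASI-DECOMPOSABLE ON A LINE — open as stated) `{α} + {e,−e} = ξ' + ξ''`: this is
      WHERE THE ROUTE-REVIEW ABSORPTION LIVES (refuter rreview1, REVIEW.md on the item: for an
      isolated `c`, `γ = Nc ∗ (η ∗_d αᵢ)` is indecomposable, quasi-decomposable, on a Hodge line,
      and `claim(γ) ⇒ claim(c)` by the transpose type-I correspondence) — so this stub carries the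
      sporadic content the crux as filed still contains; in a `(P)`-irreducible re-cut of the route
      (the refuters' `C″`) it becomes Shioda's type-I input `hash` + induction on the length, a
      support, but inside the crux AS FILED (no induction hypothesis on lower lengths) it is a
      genuine open sub-family;
    ⊔ (STUB 3, `(P)`-IRREDUCIBLE ON A LINE — open, the NEW content = `C″` on lines) neither
      decomposable, nor quasi-, nor semi-decomposable: the characters where `(Pₘ)` FAILS
      (`m = 25, 33, …`, da Silva Prop. 3.6) and which lie on Hodge lines — first instances the
      `σ₅`-standard lines at `m = 25, 35, 40` (Aoki 1987 standard elements, known), `m = 32`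
      (prime power, known), three unidentified orbits at `m = 36` (refuter census, REVIEW.md §4);
      engine foreseen by the route: distribution relation ⇒ Hecke-character identity ⇒ CM isogeny
      ⇒ correspondence, uniform in the level.

The composition `CosetAlgebraicity_of` is the trichotomy by excluded middle plus the small
cardinality computation `#{α} = 2p + 2 = 3 + 3 ⇒ p = 2` that lands the semi-decomposable branch on
the fourfold statement of STUB 1; kernel-checked, no `sorry`. None of the three stubs is the crux
or the summit reworded: STUB 1 is a theorem in print about fourfolds only; STUB 2 and STUB 3 are
the two halves of a genuine partition of the crux's instances by a decidable arithmetic property of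
the character, both halves inhabited ON LINES (`(1,1,7,14,15,16)/18` is quasi+semi-decomposable and on a
line; the `σ₅`-standard lines at `m = 25, 35, 40`, the prime-power level `m = 32` and three orbits
at `m = 36` are `(P)`-irreducible and on lines — refuter census, REVIEW.md §4 on the item), so
neither half gives the other.

## Contents

* `stub_semiDecomposable_fourfold` (STUB 1, known: Shioda's semi-decomposable input, `p = 2`),
  `stub_quasiDecomposable_onLine` (STUB 2, open; the absorbing half),
  `stub_irreducible_onLine` (STUB 3, open; `C″` on lines, load-bearing) — `sorry` ONLY here;
* `CosetAlgebraicity_of` — STUB 1 → STUB 2 → STUB 3 → the crux BY NAME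
  (`Summit.HodgeConjecture.HodgeConjecture.Theses.GaloisSieve.CosetAlgebraicity`), no `sorry`;
  `CosetAlgebraicity_of_birth` — the crux modulo exactly the three stubs (hypothesis-free; this is the
  theorem `ledger skeleton check` / `#h21_check_skeleton` reads as THE skeleton — it must precede
  `CosetAlgebraicity_of` in the checker's candidate order, which the name was chosen to ensure).

Disproof used: none on file — `ledger crux ls stmt-HodgeConjecture-14561` showed "(no workfiles
yet)" at registration (no `Disproof.lean`, no `_false_without_` theorem, no landed Negative lemma);
`ledger negatives --problem HodgeConjecture` (3 entries) has one Fermat entry, the refuted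
`DerivedTorelliFermat.K3Exhaustion` dichotomy for Hodge sextuples of `ℤ/110` — a combinatorial
exhaustion claim; no stub here asserts any exhaustion of characters.
-/

noncomputable section

namespace Summit.HodgeConjecture.HodgeConjecture.Cruxes.CosetAlgebraicity.Birth

open Literature.AlgebraicGeometry.Motives Literature.AlgebraicGeometry.HodgeTheory
open Literature.AlgebraicTopology.SingularHomology
open Summit.HodgeConjecture.HodgeConjecture.Theses.GaloisSieve (CosetAlgebraicity)

/-! ### The three registered stubs -/

/-- STUB 1 (SEMI-DECOMPOSABLE CHARACTERS OF FERMAT FOURFOLDS; known in print, M/L-sized in the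
tree) — for every level `m` and every Hodge character `α` of length `6` whose value multiset is
SEMI-DECOMPOSABLE (`{α} = x' + x''` with `x'`, `x''` triples each summing to `0 mod m`, Shioda PJA
§1 Def. (iii), tree `FermatCharacter.IsSemiDecomposable`), the eigenline `V(α) ⊂ H⁴(X⁴ₘ(ℂ); ℂ)`
(inline spelling = `fermatEigenspace m α 4`, bridge `mem_fermatEigenspace_iff`) consists of
algebraic classes of codimension `2`. Why plausibly true: it is Shioda's geometric input for the
semi-decomposable case (Math. Ann. 245 (1979) Thm. I–II / PJA §4): `x'`, `x''` are characters of
the Fermat CURVE `X¹ₘ`, the type-II map `H¹(X¹ₘ) ⊗ H¹(X¹ₘ)(1) → H⁴(X⁴ₘ)` of the inductive structure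
`X¹ₘ × X¹ₘ ⇢ X⁴ₘ`… (via `X¹ × X¹ → X⁴` of degree `m`, blow-up along `X⁰ × X⁰`) carries the
`(1,1)`-class of the character `(x', x'')` on the product surface `X¹ₘ × X¹ₘ`, algebraic by
Lefschetz `(1,1)`, onto a generator of `V(α)`; recorded in the tree as the INPUT field
`FermatCharacter.IsShiodaClosed.semi`. No Hodge-line or indecomposability hypothesis is needed.
Why it might fail / cost: in print it does not; in the tree it needs the inductive-structure
correspondence on the real carriers `complexBetti` (formalisation debt shared with the route's
support `BlockCancellation` and the tree's `Aoki1987_claim_juxtaposition` programme) and Lefschetz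
`(1,1)` for `X¹ₘ × X¹ₘ` (named fact `lefschetzOneOne_rational`). Size: L. Leans on:
`FermatCharacter.IsSemiDecomposable`, `mem_fermatEigenspace_iff`, `lefschetzOneOne_rational`,
`algebraicClasses`. [cite: Shioda1979PJA, §1 Def. (iii) and §4] [cite: Shioda1979HodgeFermat, Thm. I–II]
[cite: daSilva2021HodgeFermat, Thm. 2.2 and Cor. 2.3] -/
theorem stub_semiDecomposable_fourfold :
    ∀ (m : ℕ) [NeZero m] (α : Fin (2 * 2 + 2) → ZMod m), FermatCharacter.IsHodge α →
      FermatCharacter.IsSemiDecomposable (Finset.univ.val.map α) →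
      ∀ c : complexBetti (SmoothHypersurface.hypersurface (fermatPolynomial ℂ (2 * 2) m)) (2 * 2),
        (∀ (a : Fin (2 * 2 + 2) → ℂˣ) (ha : a ∈ diagonalStabilizer (fermatPolynomial ℂ (2 * 2) m)),
          (∀ i, a i ^ m = 1) →
            singularCohomology.map ℂ ℂ (diagonalMap (fermatPolynomial ℂ (2 * 2) m) ha) (2 * 2) c =
              (∏ i, ((a i : ℂˣ) : ℂ) ^ (α i).val) • c) →
        c ∈ algebraicClasses (SmoothHypersurface.hypersurface (fermatPolynomial ℂ (2 * 2) m)) 2 := by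
  sorry

/-- STUB 2 (QUASI-DECOMPOSABLE INDECOMPOSABLE CHARACTERS ON HODGE LINES; open as stated) — for
`p ≥ 2`, every level `m` and every Hodge character `α` of length `2p+2` which is INDECOMPOSABLE,
QUASI-DECOMPOSABLE (`{α} + {e,−e} = ξ' + ξ''` with `ξ', ξ'' ∈ Mₘ` different from `{α}`, da Silva
Def. 2.4, tree `FermatCharacter.IsQuasiDecomposable`) and ON A HODGE LINE, the eigenline `V(α)` is
algebraic. Why plausibly true: by Shioda's type-I input (da Silva Cor. 2.3 (b), tree field
`IsShiodaClosed.hash`) `V(α)` is the image of `V(e ∷ ξ̃') ⊗ V(−e ∷ ξ̃'')`, two eigenlines of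
STRICTLY SMALLER length (`≥ 2`, `< p + 1`, because `ξ', ξ'' ≠ {α}` — the combinatorial lemma inside
`IsShiodaClosed.of_shiodaConditionUpTo`), so the stub is HC for those lower eigenlines; it holds
outright whenever the pieces are surface characters or known (`m ≤ 21`, `27`, prime powers). Why it
might fail / why it is the ABSORBING half: the pieces of an on-line quasi-decomposable character
need not lie on lines — the route review (refuter rreview1, REVIEW.md + AbsorptionCert.lean on the
item) builds, from ANY isolated `c` of length `6` and level `M = 2d`, the indecomposable on-line
quasi-decomposable `γ = Nc ∗ (η ∗_d αᵢ)` of length `10` with `claim(γ) ⇒ claim(c)` (transpose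
type-I correspondence + slant product; explicit: da Silva's `(1,4,16,22,25,31)/33` is absorbed by
`p = 4`, `m = 66`, `γ = (2,8,32,50,62,55,22,2,35,62)`), so this stub contains the first open
sporadic entries and is at least as hard as they are; inside the crux AS FILED there is no
induction hypothesis on lower lengths to discharge it (in the refuters' `(P)`-irreducible re-cut
`C″` it becomes a support). One non-algebraic piece would be a counterexample to HC. Size: XL
(open). Leans on: `FermatCharacter.IsQuasiDecomposable`, `IsShiodaClosed.hash` (statement shape),
`FermatCharacter.OnHodgeLine`, `mem_fermatEigenspace_iff`.
[cite: daSilva2021HodgeFermat, Def. 2.4, Cor. 2.3 (b), Prop. 3.6] [cite: Shioda1979PJA, §1 Def. (ii)]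
[cite: Aoki1987, Thm. 1-4] -/
theorem stub_quasiDecomposable_onLine :
    ∀ (p m : ℕ) [NeZero m] (α : Fin (2 * p + 2) → ZMod m), 2 ≤ p → FermatCharacter.IsHodge α →
      ¬ FermatCharacter.IsDecomposable (Finset.univ.val.map α) →
      FermatCharacter.IsQuasiDecomposable (Finset.univ.val.map α) →
      FermatCharacter.OnHodgeLine α →
      ∀ c : complexBetti (SmoothHypersurface.hypersurface (fermatPolynomial ℂ (2 * p) m)) (2 * p),
        (∀ (a : Fin (2 * p + 2) → ℂˣ) (ha : a ∈ diagonalStabilizer (fermatPolynomial ℂ (2 * p) m)),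
          (∀ i, a i ^ m = 1) →
            singularCohomology.map ℂ ℂ (diagonalMap (fermatPolynomial ℂ (2 * p) m) ha) (2 * p) c =
              (∏ i, ((a i : ℂˣ) : ℂ) ^ (α i).val) • c) →
        c ∈ algebraicClasses (SmoothHypersurface.hypersurface (fermatPolynomial ℂ (2 * p) m)) p := by
  sorry

/-- STUB 3 (`(P)`-IRREDUCIBLE CHARACTERS ON HODGE LINES; open — load-bearing, the new content) —
for `p ≥ 2`, every level `m` and every Hodge character `α` of length `2p+2` which is neither
decomposable, nor quasi-decomposable, nor semi-decomposable (Shioda-`(P)`-IRREDUCIBLE: exactly the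
elements on which the condition `(Pₘ)` fails, tree `FermatCharacter.ShiodaCondition`) and lies ON
A HODGE LINE, the eigenline `V(α)` is algebraic. This is the refuters' minimal repair `C″` of the
crux restricted to lines (REVIEW.md: "restrict C and S to Shioda-(P)-irreducible characters … the
witness misses C″"). Why plausibly true: the known instances are exactly of this kind — Aoki's
standard elements of `σ₅`-type at `m = 25, 35, 40` (Hasse–Davenport / standard cycles, Aoki 1987
Thm. 1-4 and Cor. 2-3) and the prime-power level `m = 32` — and the route's engine (distribution
relation ⇒ Hecke-character identity ⇒ isogeny of CM factors of Fermat Jacobians ⇒ correspondence)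
is uniform in the level along a line. Why it might fail: `(P)`-irreducible Hodge lines of length
`≥ 6` are unclassified (three unidentified orbits at `m = 36` already, refuter census REVIEW.md §4);
one line type outside Aoki's standard-cycle supply is open HC, and a non-algebraic member refutes
HC. Neither implies nor is implied by STUB 2 cheaply (disjoint instance sets). Size: XL (open).
Leans on: `FermatCharacter.IsDecomposable / IsQuasiDecomposable / IsSemiDecomposable`,
`FermatCharacter.OnHodgeLine` (+ `.unitSMul / .compEquiv / .inflate`), `Aoki1987_claim_*`,
`mem_fermatEigenspace_iff`. [cite: Aoki1987, Thm. 1-4 and Cor. 2-3] [cite: AokiShioda1983, §2 Theorem (𝔅²ₘ)]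
[cite: daSilva2021HodgeFermat, Prop. 3.6] [cite: Aoki1991, Thm. 0.1] -/
theorem stub_irreducible_onLine :
    ∀ (p m : ℕ) [NeZero m] (α : Fin (2 * p + 2) → ZMod m), 2 ≤ p → FermatCharacter.IsHodge α →
      ¬ FermatCharacter.IsDecomposable (Finset.univ.val.map α) →
      ¬ FermatCharacter.IsQuasiDecomposable (Finset.univ.val.map α) →
      ¬ FermatCharacter.IsSemiDecomposable (Finset.univ.val.map α) →
      FermatCharacter.OnHodgeLine α →
      ∀ c : complexBetti (SmoothHypersurface.hypersurface (fermatPolynomial ℂ (2 * p) m)) (2 * p),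
        (∀ (a : Fin (2 * p + 2) → ℂˣ) (ha : a ∈ diagonalStabilizer (fermatPolynomial ℂ (2 * p) m)),
          (∀ i, a i ^ m = 1) →
            singularCohomology.map ℂ ℂ (diagonalMap (fermatPolynomial ℂ (2 * p) m) ha) (2 * p) c =
              (∏ i, ((a i : ℂˣ) : ℂ) ^ (α i).val) • c) →
        c ∈ algebraicClasses (SmoothHypersurface.hypersurface (fermatPolynomial ℂ (2 * p) m)) p := by
  sorry

/-! ### The composition: stub₁ → stub₂ → stub₃ → the crux, by name -/

/-- A semi-decomposable value multiset of a character of length `2p+2` forces `p = 2`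
(`#{α} = 2p + 2 = 3 + 3`). [cite: Shioda1979PJA, §1 Def. (iii) ("this occurs only if y = 3")] -/
theorem eq_two_of_isSemiDecomposable {p m : ℕ} {α : Fin (2 * p + 2) → ZMod m}
    (h : FermatCharacter.IsSemiDecomposable (Finset.univ.val.map α)) : p = 2 := by
  obtain ⟨t, u, ht, hu, -, -, hs⟩ := h
  have hcard := FermatCharacter.card_univ_val_map α
  rw [hs, Multiset.card_add, ht, hu] at hcard
  omega

/-- **THE LINE'S COMPOSITION** (kernel-checked, no `sorry`): if semi-decomposable length-6
eigenlines are algebraic (STUB 1), quasi-decomposable indecomposable on-line eigenlines are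
algebraic (STUB 2) and `(P)`-irreducible on-line eigenlines are algebraic (STUB 3), then
`CosetAlgebraicity` — trichotomy of an indecomposable on-line character by excluded middle on
`IsSemiDecomposable` / `IsQuasiDecomposable`, the semi-decomposable branch landing on `p = 2` by
`eq_two_of_isSemiDecomposable`. [cite: Shioda1979PJA, §1 Def. (i)–(iii) and condition (Pₘ)] -/
theorem CosetAlgebraicity_of :
    (∀ (m : ℕ) [NeZero m] (α : Fin (2 * 2 + 2) → ZMod m), FermatCharacter.IsHodge α →
      FermatCharacter.IsSemiDecomposable (Finset.univ.val.map α) →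
      ∀ c : complexBetti (SmoothHypersurface.hypersurface (fermatPolynomial ℂ (2 * 2) m)) (2 * 2),
        (∀ (a : Fin (2 * 2 + 2) → ℂˣ) (ha : a ∈ diagonalStabilizer (fermatPolynomial ℂ (2 * 2) m)),
          (∀ i, a i ^ m = 1) →
            singularCohomology.map ℂ ℂ (diagonalMap (fermatPolynomial ℂ (2 * 2) m) ha) (2 * 2) c =
              (∏ i, ((a i : ℂˣ) : ℂ) ^ (α i).val) • c) →
        c ∈ algebraicClasses (SmoothHypersurface.hypersurface (fermatPolynomial ℂ (2 * 2) m)) 2) →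
    (∀ (p m : ℕ) [NeZero m] (α : Fin (2 * p + 2) → ZMod m), 2 ≤ p → FermatCharacter.IsHodge α →
      ¬ FermatCharacter.IsDecomposable (Finset.univ.val.map α) →
      FermatCharacter.IsQuasiDecomposable (Finset.univ.val.map α) →
      FermatCharacter.OnHodgeLine α →
      ∀ c : complexBetti (SmoothHypersurface.hypersurface (fermatPolynomial ℂ (2 * p) m)) (2 * p),
        (∀ (a : Fin (2 * p + 2) → ℂˣ) (ha : a ∈ diagonalStabilizer (fermatPolynomial ℂ (2 * p) m)),
          (∀ i, a i ^ m = 1) →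
            singularCohomology.map ℂ ℂ (diagonalMap (fermatPolynomial ℂ (2 * p) m) ha) (2 * p) c =
              (∏ i, ((a i : ℂˣ) : ℂ) ^ (α i).val) • c) →
        c ∈ algebraicClasses (SmoothHypersurface.hypersurface (fermatPolynomial ℂ (2 * p) m)) p) →
    (∀ (p m : ℕ) [NeZero m] (α : Fin (2 * p + 2) → ZMod m), 2 ≤ p → FermatCharacter.IsHodge α →
      ¬ FermatCharacter.IsDecomposable (Finset.univ.val.map α) →
      ¬ FermatCharacter.IsQuasiDecomposable (Finset.univ.val.map α) →
      ¬ FermatCharacter.IsSemiDecomposable (Finset.univ.val.map α) →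
      FermatCharacter.OnHodgeLine α →
      ∀ c : complexBetti (SmoothHypersurface.hypersurface (fermatPolynomial ℂ (2 * p) m)) (2 * p),
        (∀ (a : Fin (2 * p + 2) → ℂˣ) (ha : a ∈ diagonalStabilizer (fermatPolynomial ℂ (2 * p) m)),
          (∀ i, a i ^ m = 1) →
            singularCohomology.map ℂ ℂ (diagonalMap (fermatPolynomial ℂ (2 * p) m) ha) (2 * p) c =
              (∏ i, ((a i : ℂˣ) : ℂ) ^ (α i).val) • c) →
        c ∈ algebraicClasses (SmoothHypersurface.hypersurface (fermatPolynomial ℂ (2 * p) m)) p) →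
    Summit.HodgeConjecture.HodgeConjecture.Theses.GaloisSieve.CosetAlgebraicity := by
  intro h₁ h₂ h₃ p m _ α hp hα hind hline c hc
  by_cases hsemi : FermatCharacter.IsSemiDecomposable (Finset.univ.val.map α)
  · -- semi-decomposable: `p = 2` and STUB 1
    obtain rfl : p = 2 := eq_two_of_isSemiDecomposable hsemi
    exact h₁ m α hα hsemi c hc
  · by_cases hquasi : FermatCharacter.IsQuasiDecomposable (Finset.univ.val.map α)
    · -- quasi-decomposable, indecomposable, on a line: STUB 2
      exact h₂ p m α hp hα hind hquasi hline c hc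
    · -- `(P)`-irreducible on a line: STUB 3
      exact h₃ p m α hp hα hind hquasi hsemi hline c hc

/-- **The crux, closed modulo exactly the three registered stubs** (the theorem the skeleton audit
reads: no hypotheses, `sorryAx` only through the three `stub_*`). -/
theorem CosetAlgebraicity_of_birth :
    Summit.HodgeConjecture.HodgeConjecture.Theses.GaloisSieve.CosetAlgebraicity :=
  CosetAlgebraicity_of stub_semiDecomposable_fourfold stub_quasiDecomposable_onLine
    stub_irreducible_onLine

end Summit.HodgeConjecture.HodgeConjecture.Cruxes.CosetAlgebraicity.Birth

end
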